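import Mathlib
import HarnessLib
import Summits.BirchSwinnertonDyer.BirchSwinnertonDyer.Theses.ManinLocalTwoThree
import Summits.BirchSwinnertonDyer.BirchSwinnertonDyer.Theorems.ManinLocalTwoThreeManinPrimeToAdditiveFiveLeGloballyTwistMinimal
import Summits.BirchSwinnertonDyer.Rank1Residual.ManinAdditive.TwistOrbitManinStatements
import Summits.BirchSwinnertonDyer.Rank1Residual.Additive.PotGoodOrdinary

/-!
# Crux `ManinPrimeToAdditiveFiveLe` (stmt-BirchSwinnertonDyer-22969) — line `neron-smooth`

Skeleton line (ideator seat bsd-idea-19, lens «dual», W-71 bind; CRUX-LEVEL ONLY — no summit and no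
leaf is proved here; BSD is not proved by any of this).  Target (route `ManinLocalTwoThree`, residual
conjunct C5):
`Summit.BirchSwinnertonDyer.BirchSwinnertonDyer.Theses.ManinLocalTwoThree.ManinPrimeToAdditiveFiveLe`
= `p ∤ c(D)` for every lattice-optimal (`Λ_E = c · Λ_f`) datum at an additive prime `p ≥ 5`.

## The dual reading of `v_p(c)` (tangent side instead of cotangent side)

Every lever in the tree on this crux is cotangent-, degree- or L-value-side (Edixhoven's valuations of
`ω_f` on the stable fibre, the `χ_{p*}`-orbit degree step, Kato's twisted values, ČNS's degree sieve,
the congruence-number laws).  The dual witness lives on the TANGENT side.  For `p ≥ 5`, ČNS give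
`ω_f ∈ Cot(𝒥₀(N)_{ℤ_p})` primitive and (Raynaud, rational singularities) `Pic⁰_{𝒳₀(N)/ℤ_p} = 𝒥₀(N)⁰`,
so for the optimal quotient `π : 𝒥₀(N) → ℰ` of Néron models

  `v_p(c) = length coker (Lie π : Lie 𝒥₀(N)_{ℤ_p} → Lie ℰ_{ℤ_p})`,

i.e. `p ∤ c` ⟺ `π` is SMOOTH at `p` ⟺ `π_s : 𝒥₀(N)⁰_{𝔽_p} → ℰ⁰_{𝔽_p} = 𝔾_a` is separable.  Two sharper
forms (ideator's notes, card `Ideas/neron-lie-witness.md`):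

* FORMAL-LOG DICHOTOMY (provable now: Honda type of an infinite-height formal group over `ℤ_p` is
  `~ p`, so `log_ℰ ∈ ℤ_p⟦T⟧`; `a_{pm}(f) = 0`; Néron mapping property; DR at the cusp):
  `log_ℰ(φ̂(q)) = c · Σ_{p ∤ n} a_n qⁿ/n`, hence  `p ∣ c` ⟺ the reduction `φ̄` is CONSTANT on the cusp
  component `C_∞ ≅ X₀(N/p²)_{𝔽_p}` of `X₀(N)_{𝔽_p}`;  `p ∤ c` ⟺ `φ̄|_{C_∞}` non-constant, and then
  `d(T ∘ φ̄) = c̄ · f̄ dq/q` on `C_∞ ∖ SS` and `T ∘ φ̄ = c̄ · θ^{p−2} f̄ / A^p + (p-th powers)`.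
* DIEUDONNÉ FORM: `π_s ∈ M := Hom(𝒥₀(N)⁰_{𝔽̄_p}, 𝔾_a) = 𝔽̄_p[F] ⊗ V^∨`, `V = ⊕_j H¹(C₁₁, I^j/I^{j+1})`
  (exponential sequence: the middle component has multiplicity `p − 1 < p`), graded by the nilpotent
  order `j` (= Edixhoven 1992's `μ_n`-weights); `π_s = Σ_i F^i ⊗ λ_i` with every `λ_i` in the
  `{a_ℓ mod p}`-eigenspace; `p ∤ c` ⟺ `λ₀ ≠ 0`.  ČNS (`p ∤ deg φ ⇒ p ∤ c`) is `λ₀(μ₀) = deg φ mod p`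
  (E's own tangent line is the witness); Edixhoven 1991 Props. 6–9 test only the TOP weight.

## The line: local-type stratification of C5 by the weight at which a witness must live

After the route helper (p587193: twist-minimal normal form, so at `p` only potentially good
reduction with `e = 12/gcd(12, v_pΔ) ∈ {3,4,6}` survives) C5 splits along the Raynaud threshold
`e < p − 1` and the ordinary/unstarred locus — the cells where the dual witness must sit at a weight
BELOW the top one:

* `stub_portEleven` (PORT, p ≥ 11): starred or not (G)-ordinary ⇒ `p ∤ c` — Edixhoven 1991 Thm. 3,
  = tree named facts `edixhoven_not_dvd_maninConstant_of_kodairaSymbol_ne` ∧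
  `edixhoven_not_dvd_maninConstant_of_not_potentiallyGoodOrdinary` + Tate's table
  (`v_pΔ ∈ {2,3,4}` ⟺ Kodaira II/III/IV at an additive `p ≥ 5`).
* `stub_tameSmall` (NEW, p ∈ {5,7}, `e(v_pΔ) < p − 1` and not (ordinary ∧ unstarred)):
  `(5; v_pΔ ∉ {2,3,9,10})`, `(7; v_pΔ ∉ {2,10}, ¬(v_pΔ = 4 ∧ (G)-ord))` ⇒ `p ∤ c`.  Edixhoven's
  separability criterion re-run below his `p > 7` threshold where Raynaud's `e ≤ p − 2` still holds
  (cells IV, IV* at 5; III, III*, IV* at 7; plus the twist-non-minimal values, vacuous here) — no Kato,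
  no Cremona table (contrast K★ of `EdixhovenFibreFiveSeven`, which reduces the starred cells to
  Kato's F″ + Cremona).
* `stub_wildSmall` (p ∈ {5,7}, `e ≥ p − 1`): `(5; v_pΔ ∈ {2,3,9,10})`, `(7; v_pΔ ∈ {2,10})` ⇒ `p ∤ c`.
  The wild small-prime cells (owned in the tree by K★ 22226 for the starred half and by the
  Kosters–Pannekoek / Teichmüller-descent items 23810/23883/23884 for the unstarred half); the dual
  witness there needs B. Conrad's `e ≤ p − 1` connected-part extension of Raynaud or the Dieudonné
  weight count at `n = 12, 24`.
* `stub_caseOne` (THE KERNEL; `p ≥ 11` with `v_pΔ ∈ {2,3,4}`, or `(7, v_pΔ = 4)`, (G)-ordinary):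
  `p ∤ c` — Edixhoven's «case 1» excluded.  Dual attack (card): `p ∣ c` ⟹ `λ₀ = … = λ_{a−1} = 0`,
  i.e. the `f̄`-eigenvector of `M` is divisible by `F` in every weight below the top; conjecturally
  this forces `ρ̄_{E,p}|_{D_p}` split with a companion form in weight `p + 1 − k(ρ̄)` AND not — the
  Gross/Coleman–Voloch dichotomy is the proposed lever; the formal-log dichotomy turns it into
  `φ̄|_{C_∞} = const` versus the non-vanishing of `θ^{p−2} f̄` on the ordinary locus (CM density).

Composition: helper → `p ≥ 11` / `p = 7` / `p = 5` → cell dispatch; sorry-free.  Sorries live only in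
the four `stub_*`.  HONEST SCOPE: `stub_portEleven` is a port of print; `stub_tameSmall` is
Edixhoven's printed METHOD outside its printed RANGE; `stub_wildSmall` and `stub_caseOne` are open
mathematics (the latter since 1991).  BSD is not proved by any of this.
-/

set_option autoImplicit false
set_option linter.dupNamespace false

noncomputable section

open WeierstrassCurve Literature.NumberTheory.EllipticCurves
  Literature.NumberTheory.EllipticCurves.ModularForms
  Summit.BirchSwinnertonDyer.Rank1Residual.ManinAdditive
  Summit.BirchSwinnertonDyer.Rank1Residual.Additive

namespace Summit.BirchSwinnertonDyer.BirchSwinnertonDyer.Cruxes.ManinPrimeToAdditiveFiveLe.NeronSmooth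

/-- STUB 1 (size XL; PORT of print) — **Edixhoven 1991 Thm. 3 at `p ≥ 11`, both readings, in
`v_pΔ`-currency.**  For `W/ℚ` globally minimal with a lattice-optimal conductor-level datum `D`,
`p ≥ 11`, `p² ∣ N(W)`: if `v_p Δ_min(W) ∉ {2,3,4}` (Kodaira type at `p` is not II, III, IV — Tate's
algorithm at `p ≥ 5`) OR `W` is not potentially good ORDINARY of type (G) at `p`, then `p ∤ c(D)`.
Verbatim the conjunction of the tree's cite-only named facts
`edixhoven_not_dvd_maninConstant_of_kodairaSymbol_ne` (Kodaira reading) and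
`edixhoven_not_dvd_maninConstant_of_not_potentiallyGoodOrdinary` ((G)-ordinary reading), transported
along Tate's table `II ↔ v_pΔ = 2`, `III ↔ 3`, `IV ↔ 4` (`p ≥ 5`).  Dual reading: on these cells the
top-weight witness exists (starred: `e ∈ {3,4,6} ≤ p − 2` and Raynaud; non-ordinary: Frobenius does
not commute with `μ_n`, Prop. 9).  Why it might fail: only as a port (the facts are cite-only,
acq-13151).  [cite: EdixhovenManin1991, Thm. 3, Props. 7–9] [cite: SilvermanATAEC1994, IV.9 Table 4.1] -/
theorem stub_portEleven :
    exists_isNewformOf →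
    ∀ {p : ℕ}, p.Prime → 11 ≤ p →
    ∀ (W : WeierstrassCurve ℚ) [W.IsElliptic] [W.IsGloballyMinimal] [NeZero (W.conductorNorm ℤ)]
      (D : ModularParametrizationData W (W.conductorNorm ℤ)),
      IsLatticeOptimal D → p ^ 2 ∣ W.conductorNorm ℤ →
      (¬ (padicValInt p W.minimalDiscriminantInt = 2 ∨ padicValInt p W.minimalDiscriminantInt = 3 ∨
          padicValInt p W.minimalDiscriminantInt = 4) ∨ ¬ TypeGOrd W p) →
      ¬ (p : ℤ) ∣ D.maninConstant := by
  sorry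

/-- STUB 2 (size L; NEW — Edixhoven's method below his threshold) — **the tame small-prime cells.**
For `W/ℚ` globally minimal, lattice-optimal conductor-level `D`, `p ∈ {5, 7}`, `p² ∣ N(W)`, `W`
twist-minimal at `p` (not a `χ_{p*}`-twist of a class with `p² ∤ N`; so potentially good at `p` with
`e = 12/gcd(12, v_pΔ) ∈ {3,4,6}`), on the cells where Raynaud's bound `e ≤ p − 2` holds and the curve
is not (potentially ordinary ∧ unstarred): `p = 5`: `v_pΔ ∉ {2,3,9,10}` (leaves IV, IV*: `e = 3`,
`j̃ = 0` supersingular at 5); `p = 7`: `v_pΔ ∉ {2,10}` and not (`v_pΔ = 4` ∧ (G)-ordinary) (leaves III,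
III*: `e = 4`, `j̃ = 1728` supersingular at 7; IV*: `e = 3`, starred) — then `p ∤ c(D)`.  Proof plan:
Edixhoven 1990 Thm. 2.1.2 (stable reduction of `X₀(p²M)`, valid `p ≥ 5`) + 1991 Props. 5–9 verbatim
with `n = 12, 24`: the `μ_n`-eigenvalue bookkeeping only uses `e(type) < p − 1`; the values
`v_pΔ ∈ {6, 7, 8+}` of type I₀*, Iₙ* are excluded by twist-minimality (to be discharged inside).  Dual
reading: top-weight witness.  Why it might fail: at `p = 5`, `n = 12` the horizontal components
`y^{p+1} = x(x−1)^{p−1}` have genus 2 and the eigenvalue count of Prop. 7 may degenerate (no printed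
check below `p = 11`); a IV*-at-5 optimal curve with `5 ∣ c` beyond `N = 5·10⁵` refutes it.
[cite: EdixhovenManin1991, Props. 5–9] [cite: Edixhoven1990StableReduction, Thm. 2.1.2]
[cite: Raynaud1974, Cor. 3.3.6] -/
theorem stub_tameSmall :
    exists_isNewformOf →
    ∀ {p : ℕ}, p.Prime →
    ∀ (W : WeierstrassCurve ℚ) [W.IsElliptic] [W.IsGloballyMinimal] [NeZero (W.conductorNorm ℤ)]
      (D : ModularParametrizationData W (W.conductorNorm ℤ)),
      IsLatticeOptimal D → p ^ 2 ∣ W.conductorNorm ℤ →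
      ¬ (∃ (W' : WeierstrassCurve ℚ), W'.IsElliptic ∧ W'.IsGloballyMinimal ∧
          IsIsogenous W (W'.quadraticTwist (((-1 : ℤ) ^ (p / 2) * p : ℤ) : ℚ)) ∧
          ¬ p ^ 2 ∣ W'.conductorNorm ℤ) →
      ((p = 5 ∧ ¬ (padicValInt p W.minimalDiscriminantInt = 2 ∨ padicValInt p W.minimalDiscriminantInt = 3 ∨
          padicValInt p W.minimalDiscriminantInt = 9 ∨ padicValInt p W.minimalDiscriminantInt = 10)) ∨
       (p = 7 ∧ ¬ (padicValInt p W.minimalDiscriminantInt = 2 ∨ padicValInt p W.minimalDiscriminantInt = 10) ∧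
          ¬ (padicValInt p W.minimalDiscriminantInt = 4 ∧ TypeGOrd W p))) →
      ¬ (p : ℤ) ∣ D.maninConstant := by
  sorry

/-- STUB 3 (size XL; open, shared territory) — **the wild small-prime cells** `e ≥ p − 1`:
`p = 5` with `v_pΔ ∈ {2,3,9,10}` (II, III, III*, II*: `e ∈ {6,4}`), `p = 7` with `v_pΔ ∈ {2,10}`
(II, II*: `e = 6`), `W` twist-minimal at `p`, lattice-optimal conductor-level `D` ⇒ `p ∤ c(D)`.  In
the tree the starred half (II*, III* at 5; II* at 7) is crux K★ `StarredOptimalManinUnitFiveSeven`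
(stmt-BirchSwinnertonDyer-22226, reduced to Kato's F″ + Cremona by `starredOptimalManinUnitFiveSeven_of_kato`)
and the unstarred half is the Kosters–Pannekoek corner / supersingular-torsion items 23883/23884
(+ the reducible residue 23810); this stub names their UNION for the optimal curve, with no
irreducibility clause.  Dual reading: Raynaud is void, so the witness must be produced at a weight
`< a` — B. Conrad's `e ≤ p − 1` theorem (Compositio 1999) on the connected part is the candidate
input at `(5, III/III*)`, `(7, II/II*)`; `(5, II/II*)` (`e = 6 > p − 1`) has no scheme-theoretic
input in print.  Why it might fail: a II*-at-5 optimal curve with `5 ∣ c` beyond Cremona's range.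
[cite: EdixhovenManin1991, §4] [cite: KostersPannekoek2017, Thm. 1.1] [cite: Conrad1999LowRamification, Thm. 1.1] -/
theorem stub_wildSmall :
    exists_isNewformOf →
    ∀ {p : ℕ}, p.Prime →
    ∀ (W : WeierstrassCurve ℚ) [W.IsElliptic] [W.IsGloballyMinimal] [NeZero (W.conductorNorm ℤ)]
      (D : ModularParametrizationData W (W.conductorNorm ℤ)),
      IsLatticeOptimal D → p ^ 2 ∣ W.conductorNorm ℤ →
      ¬ (∃ (W' : WeierstrassCurve ℚ), W'.IsElliptic ∧ W'.IsGloballyMinimal ∧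
          IsIsogenous W (W'.quadraticTwist (((-1 : ℤ) ^ (p / 2) * p : ℤ) : ℚ)) ∧
          ¬ p ^ 2 ∣ W'.conductorNorm ℤ) →
      ((p = 5 ∧ (padicValInt p W.minimalDiscriminantInt = 2 ∨ padicValInt p W.minimalDiscriminantInt = 3 ∨
          padicValInt p W.minimalDiscriminantInt = 9 ∨ padicValInt p W.minimalDiscriminantInt = 10)) ∨
       (p = 7 ∧ (padicValInt p W.minimalDiscriminantInt = 2 ∨ padicValInt p W.minimalDiscriminantInt = 10))) →
      ¬ (p : ℤ) ∣ D.maninConstant := by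
  sorry

/-- STUB 4 (size XL; THE KERNEL — open since 1991) — **Edixhoven's «case 1» excluded on the
(G)-ordinary unstarred locus.**  For `W/ℚ` globally minimal, lattice-optimal conductor-level `D`,
`p ≥ 7`, `p² ∣ N(W)`, `W` twist-minimal at `p`, `W` potentially good ORDINARY of type (G) at `p` and
`v_pΔ_min(W) ∈ {2,3,4}` (Kodaira II, III, IV; at `p = 7` only `v_pΔ = 4`, type IV, the cell II-at-7
being wild): `p ∤ c(D)`.  Printed: `v_p(c) ≤ 1` for `p ≥ 11` (Edixhoven 1991 Thm. 3); open: `= 0`.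
DUAL ATTACK (card `neron-lie-witness`): by the Lie-index identity `p ∣ c` iff the `f̄`-eigenvector
`π_s = Σ F^i ⊗ λ_i` of the Dieudonné module `Hom(𝒥₀(N)⁰_{𝔽̄_p}, 𝔾_a)` has `λ₀ = 0`; by the formal-log
dichotomy iff `φ̄` is constant on the cusp component `C_∞ ≅ X₀(N/p²)_{𝔽_p}`, iff every ordinary-CM
value `φ(y)` (`p` split in `End`, connected `p²`-structure) lies in the kernel of reduction; the
weights `0 ≤ i < a` below Edixhoven's top weight are unexamined in print, and on this locus
(`m = (p−1)a/n < (p−1)/2`, `ρ̄_{E,p}|_{I_p} ~ ω^{1+m} ⊕ ω^{−m}`) the existence of a low-weight witness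
is a companion-form / `ρ̄|_{D_p}`-splitting question (Gross 1990, Coleman–Voloch 1992).  Why it
might fail: a (G)-ordinary type-III optimal curve at `p = 11` with `11 ∥ c` (none for `N < 5·10⁵`);
multiplicity one fails across the unstarred irreducible stratum (ARS 2012 §2: 242B1, `N = 2·11²`,
`m_E = 24`, `r_E = 24·11`; cell desc-lens law E-desc-18, `x_p = 1` there, 95/95), so
`dim (M/FM)[m_f] ≥ 2` and the eigenline can hide in `F·M`: no dimension count replaces a witness.
[cite: EdixhovenManin1991, Thm. 3 and §4 case 1] [cite: Gross1990Tameness, Thm. 13.10]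
[cite: AgasheRibetStein2012, Conj. 2.2, Table 1] -/
theorem stub_caseOne :
    exists_isNewformOf →
    ∀ {p : ℕ}, p.Prime → 7 ≤ p →
    ∀ (W : WeierstrassCurve ℚ) [W.IsElliptic] [W.IsGloballyMinimal] [NeZero (W.conductorNorm ℤ)]
      (D : ModularParametrizationData W (W.conductorNorm ℤ)),
      IsLatticeOptimal D → p ^ 2 ∣ W.conductorNorm ℤ →
      ¬ (∃ (W' : WeierstrassCurve ℚ), W'.IsElliptic ∧ W'.IsGloballyMinimal ∧
          IsIsogenous W (W'.quadraticTwist (((-1 : ℤ) ^ (p / 2) * p : ℤ) : ℚ)) ∧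
          ¬ p ^ 2 ∣ W'.conductorNorm ℤ) →
      TypeGOrd W p →
      (padicValInt p W.minimalDiscriminantInt = 2 ∨ padicValInt p W.minimalDiscriminantInt = 3 ∨
          padicValInt p W.minimalDiscriminantInt = 4) →
      (p = 7 → padicValInt p W.minimalDiscriminantInt = 4) →
      ¬ (p : ℤ) ∣ D.maninConstant := by
  sorry

/-- COMPOSITION (sorry-free): the four stubs prove crux C5 `ManinPrimeToAdditiveFiveLe` BY NAME.
Twist-minimal normal form (helper p587193) → `p ≥ 11` / `p = 7` / `p = 5` (primality kills
`6, 8, 9, 10`) → dispatch on `v_pΔ_min` and (G)-ordinarity to the four cells. -/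
theorem ManinPrimeToAdditiveFiveLe_of :
    Summit.BirchSwinnertonDyer.BirchSwinnertonDyer.Theses.ManinLocalTwoThree.ManinPrimeToAdditiveFiveLe := by
  refine Summit.BirchSwinnertonDyer.BirchSwinnertonDyer.Theorems.maninLocalTwoThree_maninPrimeToAdditiveFiveLe_of_globallyTwistMinimal ?_
  intro hM hAU hC hnf W hE hGM N hN0 D hopt p hp h5 hpN hodd hdy
  haveI hpF : Fact p.Prime := ⟨hp⟩
  have hp2 : p ≠ 2 := by omega
  have hN : N = W.conductorNorm ℤ :=
    IsNewformOf.level_eq_conductorNorm_of_exists_isNewformOf hnf D.isNewformOf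
  subst hN
  have hD : IsLatticeOptimal D := hopt
  -- twist-minimality at `p` is the `q = p` instance of the helper's odd clause
  have hmin : ¬ (∃ (W' : WeierstrassCurve ℚ), W'.IsElliptic ∧ W'.IsGloballyMinimal ∧
      IsIsogenous W (W'.quadraticTwist (((-1 : ℤ) ^ (p / 2) * p : ℤ) : ℚ)) ∧
      ¬ p ^ 2 ∣ W'.conductorNorm ℤ) := by
    rintro ⟨W', hE', hM', htw, hN'⟩
    exact hodd ⟨W', p, hE', hM', hp, hp2, hpN, htw, hN'⟩
  by_cases h11 : 11 ≤ p
  · -- large primes: kernel cell or Edixhoven's port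
    by_cases hker : (padicValInt p W.minimalDiscriminantInt = 2 ∨
        padicValInt p W.minimalDiscriminantInt = 3 ∨ padicValInt p W.minimalDiscriminantInt = 4) ∧
        TypeGOrd W p
    · exact stub_caseOne hnf hp (by omega) W D hD hpN hmin hker.2 hker.1 (by intro h7; omega)
    · exact stub_portEleven hnf hp h11 W D hD hpN (by tauto)
  · -- small primes: `p ∈ {5, 7}` since `6, 8, 9, 10` are not prime
    have hp57 : p = 5 ∨ p = 7 := by
      interval_cases p
      · exact Or.inl rfl
      · exact absurd hp (by decide)
      · exact Or.inr rfl
      · exact absurd hp (by decide)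
      · exact absurd hp (by decide)
      · exact absurd hp (by decide)
    rcases hp57 with rfl | rfl
    · -- p = 5
      by_cases hw : padicValInt 5 W.minimalDiscriminantInt = 2 ∨ padicValInt 5 W.minimalDiscriminantInt = 3 ∨
          padicValInt 5 W.minimalDiscriminantInt = 9 ∨ padicValInt 5 W.minimalDiscriminantInt = 10
      · exact stub_wildSmall hnf hp W D hD hpN hmin (Or.inl ⟨rfl, hw⟩)
      · exact stub_tameSmall hnf hp W D hD hpN hmin (Or.inl ⟨rfl, hw⟩)
    · -- p = 7
      by_cases hw : padicValInt 7 W.minimalDiscriminantInt = 2 ∨ padicValInt 7 W.minimalDiscriminantInt = 10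
      · exact stub_wildSmall hnf hp W D hD hpN hmin (Or.inr ⟨rfl, hw⟩)
      · by_cases hk : padicValInt 7 W.minimalDiscriminantInt = 4 ∧ TypeGOrd W 7
        · exact stub_caseOne hnf hp (by omega) W D hD hpN hmin hk.2 (Or.inr (Or.inr hk.1))
            (fun _ => hk.1)
        · exact stub_tameSmall hnf hp W D hD hpN hmin (Or.inr ⟨rfl, hw, hk⟩)

end Summit.BirchSwinnertonDyer.BirchSwinnertonDyer.Cruxes.ManinPrimeToAdditiveFiveLe.NeronSmooth

end
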